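import Summits.RiemannHypothesis.RiemannHypothesis.Theorems.IntegerScrewScrewPolyFloorLandauPairing
import Literature.NumberTheory.LFunctions.LandauGonekFormula
import HarnessLib

/-!
# Route IntegerScrew — Abel summation over a window of zeros, in integral form

Helper file for crux `IntegerScrew.ScrewPolyFloor` (stmt-RiemannHypothesis-15757): the
partial-summation step of the RH-free tail floor in INTEGRAL form (no blocking). For a finite window
of non-trivial zeros `T₀ < |Im ρ| ≤ U` (the set `Z(U) ∖ Z(T₀)`, `Z(u) = weilZeroIndex u`) and any
weights `f(ρ)`,

  `∑_{T₀<|γ|≤U} f(ρ)/γ² = U⁻² ∑_{T₀<|γ|≤U} f(ρ) + ∫_{T₀}^{U} (2/u³) ∑_{T₀<|γ|≤u} f(ρ) du`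

(`sum_window_mul_inv_sq_eq`, from `1/γ² − 1/U² = ∫_{|γ|}^{U} 2u⁻³ du` and Fubini for a finite sum),
and its consequence for lower bounds (`abel_window_lower_bound`): if `lb` is continuous on
`[T₀, U]` and `lb(u) ≤ Re ∑_{T₀<|γ|≤u} f(ρ)` there, then
`U⁻² Re ∑_{T₀<|γ|≤U} f + ∫_{T₀}^{U} (2/u³) lb(u) du ≤ Re ∑_{T₀<|γ|≤U} f(ρ)/γ²`.
This replaces the fine blocks `[V, V(1+1/K)]` of `IntegerScrewScrewPolyFloorLandauTailFloor.lean`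
(which cost a factor `K ≍ M²` in the admissible height) by one application of the window lower
bound per height `u`.
-/

noncomputable section

open Complex Finset MeasureTheory Set intervalIntegral
open scoped Real

-- the layout-mandated namespace repeats the summit name
set_option linter.dupNamespace false

namespace Summit.RiemannHypothesis.RiemannHypothesis.Theorems.IntegerScrewLandau

open Literature.NumberTheory.LFunctions

/-! ### The window of zeros `T₀ < |Im ρ| ≤ U` -/

/-- Monotonicity of the index sets `Z(u) = {ρ : |Im ρ| ≤ u}`. [folklore] -/
theorem weilZeroIndex_toFinset_mono {u v : ℝ} (h : u ≤ v) :
    (weilZeroIndex_finite u).toFinset ⊆ (weilZeroIndex_finite v).toFinset := by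
  intro ρ hρ
  rw [mem_weilZeroIndex_toFinset] at hρ ⊢
  exact ⟨hρ.1, hρ.2.1, hρ.2.2.1, hρ.2.2.2.1, hρ.2.2.2.2.trans h⟩

/-- A zero of the window `Z(U) ∖ Z(T₀)` has `T₀ < |Im ρ| ≤ U`. [folklore] -/
theorem abs_im_of_mem_sdiff {T₀ U : ℝ} {ρ : ℂ}
    (hρ : ρ ∈ (weilZeroIndex_finite U).toFinset \ (weilZeroIndex_finite T₀).toFinset) :
    T₀ < |ρ.im| ∧ |ρ.im| ≤ U := by
  rw [Finset.mem_sdiff, mem_weilZeroIndex_toFinset, mem_weilZeroIndex_toFinset] at hρ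
  obtain ⟨⟨h0, h1, h2, h3, h4⟩, hnot⟩ := hρ
  refine ⟨?_, h4⟩
  by_contra hle
  exact hnot ⟨h0, h1, h2, h3, not_lt.1 hle⟩

/-- Cutting the window at height `u ∈ [T₀, U]`: the zeros of `Z(U) ∖ Z(T₀)` with `|Im ρ| ≤ u` are
`Z(u) ∖ Z(T₀)`. [folklore] -/
theorem filter_abs_im_le_eq {T₀ u U : ℝ} (huU : u ≤ U) :
    ((weilZeroIndex_finite U).toFinset \ (weilZeroIndex_finite T₀).toFinset).filter
        (fun ρ ↦ |ρ.im| ≤ u) =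
      (weilZeroIndex_finite u).toFinset \ (weilZeroIndex_finite T₀).toFinset := by
  ext ρ
  simp only [Finset.mem_filter, Finset.mem_sdiff, mem_weilZeroIndex_toFinset]
  constructor
  · rintro ⟨⟨⟨h0, h1, h2, h3, -⟩, hnot⟩, hu⟩
    exact ⟨⟨h0, h1, h2, h3, hu⟩, hnot⟩
  · rintro ⟨⟨h0, h1, h2, h3, hu⟩, hnot⟩
    exact ⟨⟨⟨h0, h1, h2, h3, hu.trans huU⟩, hnot⟩, hu⟩

/-- The cut sum: `∑_{ρ ∈ Z(U)∖Z(T₀)} f(ρ)·[|Im ρ| ≤ u]·w = w ∑_{ρ ∈ Z(u)∖Z(T₀)} f(ρ)` for `u ≤ U`.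
[folklore] -/
theorem sum_ite_abs_im_le_eq {T₀ u U : ℝ} (huU : u ≤ U) (f : ℂ → ℂ) (w : ℝ) :
    ∑ ρ ∈ (weilZeroIndex_finite U).toFinset \ (weilZeroIndex_finite T₀).toFinset,
        f ρ * (((if |ρ.im| ≤ u then w else 0 : ℝ)) : ℂ) =
      (w : ℂ) * ∑ ρ ∈ (weilZeroIndex_finite u).toFinset \ (weilZeroIndex_finite T₀).toFinset, f ρ := by
  classical
  rw [← filter_abs_im_le_eq (T₀ := T₀) huU, Finset.sum_filter, Finset.mul_sum]
  refine Finset.sum_congr rfl fun ρ _ ↦ ?_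
  split_ifs
  · ring
  · simp

/-! ### The weight `1/γ²` as an integral -/

/-- `1/a² − 1/U² = ∫_a^U 2u⁻³ du` for `0 < a ≤ U`. [folklore] -/
theorem inv_sq_sub_inv_sq_eq_integral {a U : ℝ} (ha : 0 < a) (haU : a ≤ U) :
    (a ^ 2)⁻¹ - (U ^ 2)⁻¹ = ∫ u in a..U, 2 / u ^ 3 := by
  have hderiv : ∀ u ∈ uIcc a U, HasDerivAt (fun u : ℝ ↦ -(u ^ 2)⁻¹) (2 / u ^ 3) u := by
    intro u hu
    rw [uIcc_of_le haU, Set.mem_Icc] at hu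
    have hu0 : u ≠ 0 := by intro h; rw [h] at hu; linarith [hu.1]
    have h := ((hasDerivAt_pow 2 u).inv (pow_ne_zero 2 hu0)).neg
    refine h.congr_deriv ?_
    rw [neg_div, neg_neg, show (2 - 1 : ℕ) = 1 from rfl, pow_one,
      div_eq_div_iff (pow_ne_zero 2 (pow_ne_zero 2 hu0)) (pow_ne_zero 3 hu0)]
    push_cast
    ring
  have hcont : ContinuousOn (fun u : ℝ ↦ 2 / u ^ 3) (uIcc a U) := by
    refine ContinuousOn.div continuousOn_const (by fun_prop) fun u hu ↦ ?_
    rw [uIcc_of_le haU, Set.mem_Icc] at hu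
    exact pow_ne_zero 3 (by intro h; rw [h] at hu; linarith [hu.1])
  rw [integral_eq_sub_of_hasDerivAt hderiv (hcont.intervalIntegrable)]
  ring

/-- The cut weight is integrable: `u ↦ [a ≤ u]·2u⁻³` on `[T₀, U]`, `T₀ > 0`. [folklore] -/
theorem intervalIntegrable_ite_inv_cube {T₀ U a : ℝ} (h0 : 0 < T₀) (hU : T₀ ≤ U) :
    IntervalIntegrable (fun u : ℝ ↦ if a ≤ u then 2 / u ^ 3 else 0) volume T₀ U := by
  have hcont : ContinuousOn (fun u : ℝ ↦ 2 / u ^ 3) (Icc T₀ U) := by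
    refine ContinuousOn.div continuousOn_const (by fun_prop) fun u hu ↦ ?_
    rw [Set.mem_Icc] at hu
    exact pow_ne_zero 3 (by intro h; rw [h] at hu; linarith [hu.1])
  have hint : IntegrableOn (fun u : ℝ ↦ 2 / u ^ 3) (Ioc T₀ U) volume :=
    (hcont.integrableOn_compact isCompact_Icc).mono_set Ioc_subset_Icc_self
  have hind := hint.indicator (measurableSet_Ici (a := a))
  rw [intervalIntegrable_iff_integrableOn_Ioc_of_le hU]
  refine hind.congr_fun (fun u _ ↦ ?_) measurableSet_Ioc
  simp only [Set.indicator_apply, Set.mem_Ici]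

/-- Complex-valued version of `intervalIntegrable_ite_inv_cube`, multiplied by a constant.
[folklore] -/
theorem intervalIntegrable_const_mul_ite_inv_cube {T₀ U a : ℝ} (h0 : 0 < T₀) (hU : T₀ ≤ U) (c : ℂ) :
    IntervalIntegrable (fun u : ℝ ↦ c * (((if a ≤ u then 2 / u ^ 3 else 0 : ℝ)) : ℂ)) volume T₀ U := by
  have h := intervalIntegrable_ite_inv_cube (a := a) h0 hU
  have h' : IntervalIntegrable (fun u : ℝ ↦ (((if a ≤ u then 2 / u ^ 3 else 0 : ℝ)) : ℂ))
      volume T₀ U := ⟨h.1.ofReal, h.2.ofReal⟩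
  exact h'.const_mul c

/-- Comparison of a real integral with the real part of a complex one. [folklore] -/
theorem integral_le_re_integral {a b : ℝ} (hab : a ≤ b) {g : ℝ → ℂ} {h : ℝ → ℝ}
    (hg : IntervalIntegrable g volume a b) (hh : IntervalIntegrable h volume a b)
    (hle : ∀ u ∈ Icc a b, h u ≤ (g u).re) :
    ∫ u in a..b, h u ≤ (∫ u in a..b, g u).re := by
  have hre : (∫ u in a..b, g u).re = ∫ u in a..b, (g u).re := by
    have h1 := (intervalIntegral_re hg).symm
    simpa using h1
  have hgre : IntervalIntegrable (fun u ↦ (g u).re) volume a b := by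
    have h1 : IntervalIntegrable (fun u ↦ RCLike.re (g u)) volume a b := ⟨hg.1.re, hg.2.re⟩
    simpa using h1
  rw [hre]
  exact integral_mono_on hab hh hgre hle

/-- `1/a² − 1/U² = ∫_{T₀}^{U} [a ≤ u]·2u⁻³ du` for `0 < T₀ ≤ a ≤ U`. [folklore] -/
theorem inv_sq_sub_inv_sq_eq_integral_ite {T₀ a U : ℝ} (h0 : 0 < T₀) (ha : T₀ ≤ a) (haU : a ≤ U) :
    (a ^ 2)⁻¹ - (U ^ 2)⁻¹ = ∫ u in T₀..U, (if a ≤ u then 2 / u ^ 3 else 0) := by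
  have ha0 : 0 < a := lt_of_lt_of_le h0 ha
  have hint := intervalIntegrable_ite_inv_cube (a := a) h0 (ha.trans haU)
  rw [← integral_add_adjacent_intervals (b := a) (hint.mono_set (by
      rw [uIcc_of_le ha, uIcc_of_le (ha.trans haU)]; exact Icc_subset_Icc le_rfl haU))
    (hint.mono_set (by
      rw [uIcc_of_le haU, uIcc_of_le (ha.trans haU)]; exact Icc_subset_Icc ha le_rfl))]
  have h1 : ∫ u in T₀..a, (if a ≤ u then 2 / u ^ 3 else 0) = 0 := by
    rw [integral_congr_Ioo_of_le ha (g := fun _ ↦ (0 : ℝ)) (fun u hu ↦ by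
      rw [Set.mem_Ioo] at hu
      show (if a ≤ u then 2 / u ^ 3 else 0) = 0
      rw [if_neg (not_le.2 hu.2)])]
    simp
  have h2 : ∫ u in a..U, (if a ≤ u then 2 / u ^ 3 else 0) = ∫ u in a..U, 2 / u ^ 3 :=
    integral_congr_Ioo_of_le haU fun u hu ↦ by
      rw [Set.mem_Ioo] at hu
      show (if a ≤ u then 2 / u ^ 3 else 0) = 2 / u ^ 3
      rw [if_pos hu.1.le]
  rw [h1, h2, zero_add, inv_sq_sub_inv_sq_eq_integral ha0 haU]

/-! ### Abel summation over the window -/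

/-- **Abel summation over a window of zeros, integral form.** For `0 < T₀ ≤ U` and any
`f : ℂ → ℂ`:
`∑_{T₀<|γ|≤U} f(ρ)/γ² = U⁻² ∑_{T₀<|γ|≤U} f(ρ) + ∫_{T₀}^{U} ∑_{T₀<|γ|≤U} f(ρ)·[|γ| ≤ u]·2u⁻³ du`
(the inner sum is `(2/u³) ∑_{T₀<|γ|≤u} f(ρ)`, `sum_ite_abs_im_le_eq`). [folklore] -/
theorem sum_window_mul_inv_sq_eq {T₀ U : ℝ} (h0 : 0 < T₀) (hU : T₀ ≤ U) (f : ℂ → ℂ) :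
    ∑ ρ ∈ (weilZeroIndex_finite U).toFinset \ (weilZeroIndex_finite T₀).toFinset,
        f ρ * ((((ρ.im ^ 2)⁻¹ : ℝ)) : ℂ) =
      (∑ ρ ∈ (weilZeroIndex_finite U).toFinset \ (weilZeroIndex_finite T₀).toFinset, f ρ) *
          ((((U ^ 2)⁻¹ : ℝ)) : ℂ) +
        ∫ u in T₀..U, ∑ ρ ∈ (weilZeroIndex_finite U).toFinset \ (weilZeroIndex_finite T₀).toFinset,
          f ρ * (((if |ρ.im| ≤ u then 2 / u ^ 3 else 0 : ℝ)) : ℂ) := by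
  set B := (weilZeroIndex_finite U).toFinset \ (weilZeroIndex_finite T₀).toFinset with hB
  -- integrability of each cut term
  have hint : ∀ ρ ∈ B, IntervalIntegrable
      (fun u : ℝ ↦ f ρ * (((if |ρ.im| ≤ u then 2 / u ^ 3 else 0 : ℝ)) : ℂ)) volume T₀ U := by
    intro ρ _
    exact intervalIntegrable_const_mul_ite_inv_cube h0 hU (f ρ)
  rw [integral_finsetSum hint, Finset.sum_mul, ← Finset.sum_add_distrib]
  refine Finset.sum_congr rfl fun ρ hρ ↦ ?_
  obtain ⟨hlo, hhi⟩ := abs_im_of_mem_sdiff hρ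
  rw [intervalIntegral.integral_const_mul, intervalIntegral.integral_ofReal,
    ← inv_sq_sub_inv_sq_eq_integral_ite h0 hlo.le hhi, ← sq_abs ρ.im]
  push_cast
  ring

/-- **Abel summation, lower-bound form.** For `0 < T₀ ≤ U`, `f : ℂ → ℂ`, and `lb` continuous on
`[T₀, U]` with `lb(u) ≤ Re ∑_{T₀<|γ|≤u} f(ρ)` for `u ∈ [T₀, U]`:
`U⁻² Re ∑_{T₀<|γ|≤U} f(ρ) + ∫_{T₀}^{U} (2/u³) lb(u) du ≤ Re ∑_{T₀<|γ|≤U} f(ρ)/γ²`. [folklore] -/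
theorem abel_window_lower_bound :
    ∀ (T₀ U : ℝ), 0 < T₀ → T₀ ≤ U → ∀ (f : ℂ → ℂ) (lb : ℝ → ℝ), ContinuousOn lb (Set.Icc T₀ U) →
      (∀ u ∈ Set.Icc T₀ U, lb u ≤
        (∑ ρ ∈ (weilZeroIndex_finite u).toFinset \ (weilZeroIndex_finite T₀).toFinset, f ρ).re) →
      (∑ ρ ∈ (weilZeroIndex_finite U).toFinset \ (weilZeroIndex_finite T₀).toFinset, f ρ).re / U ^ 2 +
          ∫ u in T₀..U, 2 / u ^ 3 * lb u ≤
        (∑ ρ ∈ (weilZeroIndex_finite U).toFinset \ (weilZeroIndex_finite T₀).toFinset,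
          f ρ * ((((ρ.im ^ 2)⁻¹ : ℝ)) : ℂ)).re := by
  intro T₀ U h0 hU f lb hlb hle
  have hU0 : 0 < U := lt_of_lt_of_le h0 hU
  -- integrability of the cut sum and of the lower bound
  have hSint : IntervalIntegrable (fun u : ℝ ↦
      ∑ ρ ∈ (weilZeroIndex_finite U).toFinset \ (weilZeroIndex_finite T₀).toFinset,
        f ρ * (((if |ρ.im| ≤ u then 2 / u ^ 3 else 0 : ℝ)) : ℂ)) volume T₀ U := by
    have h := IntervalIntegrable.sum (μ := volume) (a := T₀) (b := U)
      ((weilZeroIndex_finite U).toFinset \ (weilZeroIndex_finite T₀).toFinset)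
      fun ρ _ ↦ intervalIntegrable_const_mul_ite_inv_cube (a := |ρ.im|) h0 hU (f ρ)
    rw [Finset.sum_fn] at h
    exact h
  have hwcont : ContinuousOn (fun u : ℝ ↦ 2 / u ^ 3) (Icc T₀ U) := by
    refine ContinuousOn.div continuousOn_const (by fun_prop) fun u hu ↦ ?_
    rw [Set.mem_Icc] at hu
    exact pow_ne_zero 3 (by intro h; rw [h] at hu; linarith [hu.1])
  have hlbint : IntervalIntegrable (fun u : ℝ ↦ 2 / u ^ 3 * lb u) volume T₀ U := by
    refine ContinuousOn.intervalIntegrable ?_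
    rw [uIcc_of_le hU]
    exact hwcont.mul hlb
  -- the identity
  rw [sum_window_mul_inv_sq_eq h0 hU f, Complex.add_re]
  have hre1 : ((∑ ρ ∈ (weilZeroIndex_finite U).toFinset \ (weilZeroIndex_finite T₀).toFinset, f ρ) *
      ((((U ^ 2)⁻¹ : ℝ)) : ℂ)).re =
      (∑ ρ ∈ (weilZeroIndex_finite U).toFinset \ (weilZeroIndex_finite T₀).toFinset, f ρ).re /
        U ^ 2 := by
    rw [Complex.mul_re, Complex.ofReal_re, Complex.ofReal_im, mul_zero, sub_zero, div_eq_mul_inv]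
  rw [hre1]
  refine add_le_add le_rfl (integral_le_re_integral hU hSint hlbint fun u hu ↦ ?_)
  rw [Set.mem_Icc] at hu
  have hw0 : 0 ≤ 2 / u ^ 3 := by
    have : 0 < u := lt_of_lt_of_le h0 hu.1
    positivity
  rw [sum_ite_abs_im_le_eq hu.2 f (2 / u ^ 3), Complex.re_ofReal_mul]
  exact mul_le_mul_of_nonneg_left (hle u ⟨hu.1, hu.2⟩) hw0

end Summit.RiemannHypothesis.RiemannHypothesis.Theorems.IntegerScrewLandau

end
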